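import Summits.AtomisticToContinuum.FouriersLaw.Theorems.OddSectorIrreversibilityConeScaleCorrectorOfMemoryTimeBound
import Summits.AtomisticToContinuum.FouriersLaw.Theorems.OddSectorIrreversibilityConeScaleCorrectorStubCorrectorWitnessBoundSqrtN
import Summits.AtomisticToContinuum.FouriersLaw.Theorems.OddSectorIrreversibilityOddResponseBoundIntensive
import Summits.AtomisticToContinuum.FouriersLaw.Theorems.OddSectorIrreversibilityOddDensityIsCorrectorDetailedBalance

/-!
# `ConeScaleCorrector` (E1), line Sketch: the memory-time stub (M) sits between E1 (`N²`) and the CUBIC corrector bound (`N³`)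

Support file for crux stmt-AtomisticToContinuum-14069 (`OddSectorIrreversibility.ConeScaleCorrector`, E1), line
`Sketch` (card `memory-time-bootstrap`), registered stub (M) `stub_memoryTimeBound`
(`∫u² dμ_T ≤ A·N·∫u·J_tot dμ_T + B·N²·Z` for every a.e.-limit `u` of the finite-horizon Kubo correctors of the
equilibrium OPEN chain; `μ_T = OddSectorLocality.gibbsWeight`, mass `Z`). (M) is NOT proved here (open,
supplier-less — the crux's wall). What this file lands is the exact position of (M) in the tree's lattice of
corrector-size statements, as theorems over the registered signature taken as hypothesis (verbatim):

* `memoryTimeBound_of_coneScaleCorrector` — **E1 ⟹ (M)** (`A := 0`, `B := C`): together with the landed glue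
  `coneScaleCorrector_of_memoryTimeBound_of_cruxes` ((M) → `TapLeakBound` → `SubBallisticWindow` → E1, p139274),
  (M) and E1 are EQUIVALENT given the two sibling cruxes P, E2.
* `cubicCorrector_of_memoryTimeBound` — **(M) ⟹ the cubic bound** `∫u² dμ_T ≤ C·N³·Z` for every a.e.-limit
  corrector, UNCONDITIONALLY in the siblings: (M) and the landed `√N`-Cauchy–Schwarz pairing
  `stub_correctorWitnessBound_sqrtN` (`∫u·J_tot ≤ K√N‖u‖√Z`, from the `N`-uniform statics `‖J_tot‖² ≤ K²·N·Z`) give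
  `‖u‖² ≤ A·N·K√N‖u‖√Z + B·N²·Z`, whose solution is `‖u‖² ≤ (A²K² + 2|B|)·N³·Z`. The cubic exponent is
  order-tight at the harmonic member (`‖u‖² ≍ N³` there, `Negative/Floors.harmonic_corrector_exceeds`), where (M)
  holds with `A → 1.31` (card calibration, kit j013519 A) while E1 fails: (M) is CLASS-BLIND, and this is its sharp
  unconditional consequence.
* `kuboCorrectorOddCubic_of_memoryTimeBound` — hence **(M) alone supplies route (K)'s `N`-uniform stub S4k**
  `KuboCorrectorOddCubic` of crux `ExtensiveSnapshotIrreversibility` (stmt-AtomisticToContinuum-9121; hypothesis of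
  the landed `ClausiusBudget.oddCorrectorBound_of_kuboCorrectorOddCubic`, stated here verbatim: Gibbs probability
  measure, `∫(u − u∘Θ)² dμ_T ≤ C·N³` for `N ≥ 2`), which today is fed only by E1
  (`ClausiusBudget.kuboCorrectorOddCubic_of_coneScale`). One supplier-less `N`-uniform statement (M), true at the
  harmonic member, thus serves BOTH routes: E1 on this route (with P, E2) and S4k on route (K) (with nothing else).

No definitions; no route statement is asserted unconditionally; nothing here closes the crux.
-/

noncomputable section

open MeasureTheory Filter Topology Set
open scoped ENNReal NNReal
open Literature.MathematicalPhysics.KineticTheory.HeatConduction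
open Literature.MathematicalPhysics.KineticTheory.OddSectorLocality

namespace Summit.AtomisticToContinuum.FouriersLaw.Theorems.OddSectorIrreversibility

/-- **E1 ⟹ (M).** The cone-scale bound `∫u² ≤ C·N²·Z` is the memory-time bound with `A = 0`, `B = C`
(the registered stub (M) verbatim as conclusion; the route decl `ConeScaleCorrector` by name as hypothesis).
[folklore] -/
theorem memoryTimeBound_of_coneScaleCorrector :
    Summit.AtomisticToContinuum.FouriersLaw.Theses.OddSectorIrreversibility.ConeScaleCorrector →
    (∀ ω₂ lam β γ : ℝ, 0 < ω₂ → 0 < lam → 0 < β → 0 < γ → ∀ T : ℝ, 0 < T → ∃ A B : ℝ, 0 ≤ A ∧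
      ∀ (N : ℕ) (u : Literature.MathematicalPhysics.KineticTheory.HeatConduction.PhaseSpace N → ℝ),
      (∀ᵐ x ∂(Literature.MathematicalPhysics.KineticTheory.OddSectorLocality.gibbsWeight ω₂ lam β γ T N),
        Filter.Tendsto (fun τ : ℝ => ∫ t in Set.Ioc (0 : ℝ) τ,
          Literature.MathematicalPhysics.KineticTheory.OddSectorLocality.currentForecast ω₂ lam β γ T N t x)
          Filter.atTop (nhds (u x))) →
      MeasureTheory.MemLp u 2 (Literature.MathematicalPhysics.KineticTheory.OddSectorLocality.gibbsWeight ω₂ lam β γ T N) ∧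
      ∫ x, (u x) ^ 2 ∂(Literature.MathematicalPhysics.KineticTheory.OddSectorLocality.gibbsWeight ω₂ lam β γ T N) ≤
        A * (N : ℝ) * (∫ x, u x * (∑ i : Fin N,
            (Literature.MathematicalPhysics.KineticTheory.HeatConduction.pinnedChain ω₂ lam β γ).bondCurrent N i x)
            ∂(Literature.MathematicalPhysics.KineticTheory.OddSectorLocality.gibbsWeight ω₂ lam β γ T N)) +
        B * (N : ℝ) ^ 2 * ∫ x, Real.exp
            (-((Literature.MathematicalPhysics.KineticTheory.HeatConduction.pinnedChain ω₂ lam β γ).hamiltonian N x) / T)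
            ∂MeasureTheory.volume) := by
  intro hE ω₂ lam β γ hω hl hβ hγ T hT
  obtain ⟨C, hC⟩ := hE ω₂ lam β γ hω hl hβ hγ T hT
  refine ⟨0, C, le_rfl, fun N u hu => ?_⟩
  have hEu := hC N u
  dsimp only at hEu
  obtain ⟨hmem, hbound⟩ := hEu hu
  refine ⟨hmem, ?_⟩
  change ∫ x, (u x) ^ 2 ∂(gibbsWeight ω₂ lam β γ T N) ≤ _ at hbound
  have e : (0 : ℝ) * (N : ℝ) * (∫ x, u x * (∑ i : Fin N, (pinnedChain ω₂ lam β γ).bondCurrent N i x)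
      ∂(gibbsWeight ω₂ lam β γ T N)) = 0 := by ring
  rw [e, zero_add]
  exact hbound

/-- **(M) ⟹ the cubic corrector bound.** The memory-time bound (M) (registered stub, verbatim as hypothesis) and
the landed `√N`-Cauchy–Schwarz pairing `∫u·J_tot dμ_T ≤ K√N‖u‖√Z` (`stub_correctorWitnessBound_sqrtN`) give
`∫u² dμ_T ≤ (A²K² + 2|B|)·N³·Z` for every a.e.-limit corrector, all `N`: the quadratic inequality
`x² ≤ (A N K √N √Z)·x + |B| N² Z` in `x = ‖u‖`. Class-blind (true at the harmonic member, where `N³` is attained).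
[folklore] -/
theorem cubicCorrector_of_memoryTimeBound :
    (∀ ω₂ lam β γ : ℝ, 0 < ω₂ → 0 < lam → 0 < β → 0 < γ → ∀ T : ℝ, 0 < T → ∃ A B : ℝ, 0 ≤ A ∧
      ∀ (N : ℕ) (u : Literature.MathematicalPhysics.KineticTheory.HeatConduction.PhaseSpace N → ℝ),
      (∀ᵐ x ∂(Literature.MathematicalPhysics.KineticTheory.OddSectorLocality.gibbsWeight ω₂ lam β γ T N),
        Filter.Tendsto (fun τ : ℝ => ∫ t in Set.Ioc (0 : ℝ) τ,
          Literature.MathematicalPhysics.KineticTheory.OddSectorLocality.currentForecast ω₂ lam β γ T N t x)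
          Filter.atTop (nhds (u x))) →
      MeasureTheory.MemLp u 2 (Literature.MathematicalPhysics.KineticTheory.OddSectorLocality.gibbsWeight ω₂ lam β γ T N) ∧
      ∫ x, (u x) ^ 2 ∂(Literature.MathematicalPhysics.KineticTheory.OddSectorLocality.gibbsWeight ω₂ lam β γ T N) ≤
        A * (N : ℝ) * (∫ x, u x * (∑ i : Fin N,
            (Literature.MathematicalPhysics.KineticTheory.HeatConduction.pinnedChain ω₂ lam β γ).bondCurrent N i x)
            ∂(Literature.MathematicalPhysics.KineticTheory.OddSectorLocality.gibbsWeight ω₂ lam β γ T N)) +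
        B * (N : ℝ) ^ 2 * ∫ x, Real.exp
            (-((Literature.MathematicalPhysics.KineticTheory.HeatConduction.pinnedChain ω₂ lam β γ).hamiltonian N x) / T)
            ∂MeasureTheory.volume) →
    (∀ ω₂ lam β γ : ℝ, 0 < ω₂ → 0 < lam → 0 < β → 0 < γ → ∀ T : ℝ, 0 < T → ∃ C : ℝ,
      ∀ (N : ℕ) (u : Literature.MathematicalPhysics.KineticTheory.HeatConduction.PhaseSpace N → ℝ),
      (∀ᵐ x ∂(Literature.MathematicalPhysics.KineticTheory.OddSectorLocality.gibbsWeight ω₂ lam β γ T N),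
        Filter.Tendsto (fun τ : ℝ => ∫ t in Set.Ioc (0 : ℝ) τ,
          Literature.MathematicalPhysics.KineticTheory.OddSectorLocality.currentForecast ω₂ lam β γ T N t x)
          Filter.atTop (nhds (u x))) →
      MeasureTheory.MemLp u 2 (Literature.MathematicalPhysics.KineticTheory.OddSectorLocality.gibbsWeight ω₂ lam β γ T N) ∧
      ∫ x, (u x) ^ 2 ∂(Literature.MathematicalPhysics.KineticTheory.OddSectorLocality.gibbsWeight ω₂ lam β γ T N) ≤
        C * (N : ℝ) ^ 3 * ∫ x, Real.exp
            (-((Literature.MathematicalPhysics.KineticTheory.HeatConduction.pinnedChain ω₂ lam β γ).hamiltonian N x) / T)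
            ∂MeasureTheory.volume) := by
  intro hM ω₂ lam β γ hω hl hβ hγ T hT
  obtain ⟨A, B, hA, hM'⟩ := hM ω₂ lam β γ hω hl hβ hγ T hT
  obtain ⟨K, hK0, hK⟩ := stub_correctorWitnessBound_sqrtN ω₂ lam β γ hω hl.le hβ.le T hT
  refine ⟨A ^ 2 * K ^ 2 + 2 * |B|, fun N u hu => ?_⟩
  obtain ⟨hmem, hineq⟩ := hM' N u hu
  have hw := hK N u hmem
  refine ⟨hmem, ?_⟩
  set I := ∫ x, (u x) ^ 2 ∂(gibbsWeight ω₂ lam β γ T N) with hI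
  set G := ∫ x, u x * (∑ i : Fin N, (pinnedChain ω₂ lam β γ).bondCurrent N i x)
    ∂(gibbsWeight ω₂ lam β γ T N) with hG
  set z := ∫ x, Real.exp (-((pinnedChain ω₂ lam β γ).hamiltonian N x) / T)
    ∂(volume : Measure (PhaseSpace N)) with hz
  have hz0 : 0 ≤ z := integral_nonneg fun _ => (Real.exp_pos _).le
  have hI0 : 0 ≤ I := integral_nonneg fun _ => sq_nonneg _
  have hN0 : (0 : ℝ) ≤ N := Nat.cast_nonneg N
  -- x := ‖u‖, with x² = I
  set x := Real.sqrt I with hx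
  have hxI : x ^ 2 = I := Real.sq_sqrt hI0
  have hsz : Real.sqrt z ^ 2 = z := Real.sq_sqrt hz0
  have hsN : Real.sqrt (N : ℝ) ^ 2 = N := Real.sq_sqrt hN0
  -- chain (M) and the √N pairing: I ≤ A N (K √N x √z) + B N² z
  have h1 : I ≤ A * N * (K * Real.sqrt (N : ℝ) * x * Real.sqrt z) + B * (N : ℝ) ^ 2 * z := by
    have hAN : 0 ≤ A * N := mul_nonneg hA hN0
    have := mul_le_mul_of_nonneg_left hw hAN
    linarith
  have h2 : I ≤ (A * N * K * Real.sqrt (N : ℝ) * Real.sqrt z) * x + |B| * (N : ℝ) ^ 2 * z := by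
    have e1 : A * N * (K * Real.sqrt (N : ℝ) * x * Real.sqrt z) =
        (A * N * K * Real.sqrt (N : ℝ) * Real.sqrt z) * x := by ring
    have h4 : B * (N : ℝ) ^ 2 * z ≤ |B| * (N : ℝ) ^ 2 * z := by
      apply mul_le_mul_of_nonneg_right _ hz0
      exact mul_le_mul_of_nonneg_right (le_abs_self _) (by positivity)
    linarith
  -- quadratic inequality in x
  rw [← hxI] at h2
  have h5 := sq_le_sq_add_two_mul_of_sq_le h2
  rw [hxI] at h5
  have e2 : (A * N * K * Real.sqrt (N : ℝ) * Real.sqrt z) ^ 2 = A ^ 2 * K ^ 2 * (N : ℝ) ^ 3 * z := by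
    have e2' : (A * N * K * Real.sqrt (N : ℝ) * Real.sqrt z) ^ 2 =
        A ^ 2 * K ^ 2 * (N : ℝ) ^ 2 * Real.sqrt (N : ℝ) ^ 2 * Real.sqrt z ^ 2 := by ring
    rw [e2', hsN, hsz]
    ring
  rw [e2] at h5
  have hNN : (N : ℝ) ^ 2 ≤ (N : ℝ) ^ 3 := by
    rcases Nat.eq_zero_or_pos N with h0 | hpos
    · simp [h0]
    · have h1' : (1 : ℝ) ≤ N := by exact_mod_cast hpos
      nlinarith
  have h6 : |B| * (N : ℝ) ^ 2 * z ≤ |B| * (N : ℝ) ^ 3 * z := by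
    apply mul_le_mul_of_nonneg_right _ hz0
    exact mul_le_mul_of_nonneg_left hNN (abs_nonneg _)
  have e3 : (A ^ 2 * K ^ 2 + 2 * |B|) * (N : ℝ) ^ 3 * z =
      A ^ 2 * K ^ 2 * (N : ℝ) ^ 3 * z + 2 * (|B| * (N : ℝ) ^ 3 * z) := by ring
  linarith

/-- **(M) ⟹ S4k of route (K).** The memory-time bound (M) (registered stub of crux stmt-14069, verbatim as
hypothesis) implies the `N`-uniform stub S4k `KuboCorrectorOddCubic` of crux `ExtensiveSnapshotIrreversibility`
(stmt-AtomisticToContinuum-9121), stated verbatim as the hypothesis of the landed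
`ClausiusBudget.oddCorrectorBound_of_kuboCorrectorOddCubic`: over the Gibbs PROBABILITY measure,
`∫ (u − u∘Θ)² dμ_T ≤ C·N³` for `N ≥ 2` and every `u ∈ L²(μ_T)` that is the a.e.-limit of the finite-horizon Kubo
integrals of the total current. Proof: `cubicCorrector_of_memoryTimeBound`, the normalisation `e^{−H/T}dx = Z • μ_T`
and flip-invariance of `μ_T` (`∫(u − u∘Θ)² ≤ 4∫u²`); constant `4·max C 0`. [folklore] -/
theorem kuboCorrectorOddCubic_of_memoryTimeBound :
    (∀ ω₂ lam β γ : ℝ, 0 < ω₂ → 0 < lam → 0 < β → 0 < γ → ∀ T : ℝ, 0 < T → ∃ A B : ℝ, 0 ≤ A ∧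
      ∀ (N : ℕ) (u : Literature.MathematicalPhysics.KineticTheory.HeatConduction.PhaseSpace N → ℝ),
      (∀ᵐ x ∂(Literature.MathematicalPhysics.KineticTheory.OddSectorLocality.gibbsWeight ω₂ lam β γ T N),
        Filter.Tendsto (fun τ : ℝ => ∫ t in Set.Ioc (0 : ℝ) τ,
          Literature.MathematicalPhysics.KineticTheory.OddSectorLocality.currentForecast ω₂ lam β γ T N t x)
          Filter.atTop (nhds (u x))) →
      MeasureTheory.MemLp u 2 (Literature.MathematicalPhysics.KineticTheory.OddSectorLocality.gibbsWeight ω₂ lam β γ T N) ∧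
      ∫ x, (u x) ^ 2 ∂(Literature.MathematicalPhysics.KineticTheory.OddSectorLocality.gibbsWeight ω₂ lam β γ T N) ≤
        A * (N : ℝ) * (∫ x, u x * (∑ i : Fin N,
            (Literature.MathematicalPhysics.KineticTheory.HeatConduction.pinnedChain ω₂ lam β γ).bondCurrent N i x)
            ∂(Literature.MathematicalPhysics.KineticTheory.OddSectorLocality.gibbsWeight ω₂ lam β γ T N)) +
        B * (N : ℝ) ^ 2 * ∫ x, Real.exp
            (-((Literature.MathematicalPhysics.KineticTheory.HeatConduction.pinnedChain ω₂ lam β γ).hamiltonian N x) / T)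
            ∂MeasureTheory.volume) →
    ∀ ω₂ lam β γ : ℝ, 0 < ω₂ → 0 < lam → 0 < β → 0 < γ → ∀ T : ℝ, 0 < T → ∃ C : ℝ,
      ∀ (N : ℕ) (u : PhaseSpace N → ℝ), 2 ≤ N →
        let P := pinnedChain ω₂ lam β γ;
        let μT := P.gibbsMeasure N T;
        let J : PhaseSpace N → ℝ := fun z => ∑ i : Fin N, P.bondCurrent N i z;
        MemLp u 2 μT →
        (∀ᵐ x ∂μT, Tendsto (fun τ : ℝ => ∫ t in Set.Ioc (0 : ℝ) τ,
            (∫ y, J y ∂(P.transitionKernel N T T t.toNNReal x))) atTop (𝓝 (u x))) →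
        ∫ x, (u x - u (x.1, -x.2)) ^ 2 ∂μT ≤ C * (N : ℝ) ^ 3 := by
  intro hM ω₂ lam β γ hω hl hβ hγ T hT
  obtain ⟨C, hC⟩ := cubicCorrector_of_memoryTimeBound hM ω₂ lam β γ hω hl hβ hγ T hT
  refine ⟨4 * max C 0, fun N u _hN => ?_⟩
  intro P μT J hu2 hulim
  -- the unnormalised weight is `Z •` the Gibbs measure
  set Z : ℝ := ∫ x, Real.exp (-(P.hamiltonian N x) / T) with hZ
  have hZpos : 0 < Z := OddResponseBound.Intensive.integral_gibbsWeight_pos hω hl.le hβ.le γ N hT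
  have hsmul := OddResponseBound.Intensive.withDensity_gibbs_eq_smul_gibbsMeasure hω hl.le hβ.le γ N hT
  have hc0 : ENNReal.ofReal Z ≠ 0 := (ENNReal.ofReal_pos.mpr hZpos).ne'
  have hlimT := (OddResponseBound.Intensive.ae_smul_iff' hsmul hc0).mpr hulim
  have hEu := hC N u
  obtain ⟨-, hbound⟩ := hEu hlimT
  change ∫ x, (u x) ^ 2 ∂((volume : Measure (PhaseSpace N)).withDensity
      (fun x => ENNReal.ofReal (Real.exp (-(P.hamiltonian N x) / T)))) ≤ C * (N : ℝ) ^ 3 * Z at hbound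
  rw [OddResponseBound.Intensive.integral_eq_toReal_mul_of_eq_smul hsmul, ENNReal.toReal_ofReal hZpos.le]
    at hbound
  -- `∫ u² dμ_T ≤ C N³`
  have hu2b : ∫ x, (u x) ^ 2 ∂μT ≤ C * (N : ℝ) ^ 3 := by
    refine le_of_mul_le_mul_left ?_ hZpos
    calc Z * ∫ x, (u x) ^ 2 ∂μT ≤ C * (N : ℝ) ^ 3 * Z := hbound
      _ = Z * (C * (N : ℝ) ^ 3) := by ring
  -- the odd part costs a factor `4` (flip-invariance of `μ_T`)
  have hodd : ∫ x, (u x - u (x.1, -x.2)) ^ 2 ∂μT ≤ 4 * ∫ x, (u x) ^ 2 ∂μT :=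
    OddResponseBound.Intensive.integral_sub_comp_sq_le (measurePreserving_reversal_gibbsMeasure P N T) hu2
  calc ∫ x, (u x - u (x.1, -x.2)) ^ 2 ∂μT ≤ 4 * ∫ x, (u x) ^ 2 ∂μT := hodd
    _ ≤ 4 * (max C 0 * (N : ℝ) ^ 3) := by
        refine mul_le_mul_of_nonneg_left ?_ (by norm_num)
        exact hu2b.trans (mul_le_mul_of_nonneg_right (le_max_left _ _) (by positivity))
    _ = 4 * max C 0 * (N : ℝ) ^ 3 := by ring

end Summit.AtomisticToContinuum.FouriersLaw.Theorems.OddSectorIrreversibility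

end
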